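import Mathlib
import Literature.LinearAlgebra.Matrix.CharpolySignAlternation
import HarnessLib

/-!
# Renegar's description of a spectrahedron with a positive definite point (FGPRT 2015, Thm 5.10)

Sources. H. Fawzi, J. Gouveia, P. A. Parrilo, R. Z. Robinson, R. R. Thomas, *Positive semidefinite
rank*, Math. Program. 153 (2015) [FawziEtAl2015], Theorem 5.10 (held text `paper:arxiv-1407.4095`,
p0016; = J. Gouveia, P. Parrilo, R. Thomas, Math. OR 38 (2013), Thm 4.16), quoting J. Renegar,
*Hyperbolic programs, and their derivative relaxations*, Found. Comput. Math. 6 (2006) [Renegar2006]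
(Prop. 18: `p^{(i)}_e(x) = i! p(e) σ_{n−i}(λ(x))`; Thm. 20 / eq. (3): the hyperbolicity cone is
`{x : σ_j(λ(x)) ≥ 0 ∀ j}`), verbatim: "Let `Q = {z ∈ ℝ^m : C + Σ z_i A_i ⪰ 0}` be a spectrahedron
with `E := C + Σ z'_i A_i ≻ 0` for some `z' ∈ Q`, and `C, A_i` are symmetric matrices of size
`k × k`. Then `Q` is a semialgebraic set described by `g^{(i)}(z) ≥ 0` for `i = 1, …, k` where
`g^{(0)}(z) := det(C + Σ z_i A_i)` and `g^{(i)}(z)` is the `i`-th Renegar derivative of `g^{(0)}(z)`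
in direction `E`."

Reading. `g^{(i)}(z)` is the `i`-th derivative at `t = 0` of `t ↦ det(C + Σ z_j A_j + tE)` (the
`i`-th directional derivative of `det` along `E`, i.e. Renegar's `p^{(i)}` for the hyperbolic
polynomial `det` restricted to the pencil, in the direction of its positive definite point `E`);
the describing family is `g^{(0)}, …, g^{(k−1)}` — the printed "`i = 1, …, k`" is an index slip
(`g^{(k)} ≡ k! det E > 0`, and without `g^{(0)} ≥ 0` one only gets Renegar's derivative cone).
Everything is PROVED (matrix form, no hyperbolicity vocabulary needed):
* `posSemidef_iff_coeff_det_add_smul_nonneg`: for real symmetric `Y` and `E ≻ 0` of size `k`,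
  `Y ⪰ 0 ⟺ coeff_i det(Y + tE) ≥ 0 ∀ i < k` — write `E = RᵀR` (`R` invertible, spectral theorem),
  `det(Y + tE) = (det R)² det(W + tI) = (det R)² ∏ (t + λ_j(W))` for `W = R⁻ᵀYR⁻¹`, whose
  coefficients are the elementary symmetric functions of the eigenvalues of `W`, all `≥ 0` iff
  `W ⪰ 0` (the tree's `forall_nonneg_iff_esymmSum_nonneg`, Horn–Johnson Cor. 7.2.4) iff `Y ⪰ 0`;
* `posSemidef_iff_iterate_derivative_det_add_smul_nonneg`: the same with
  `(d/dt)^i det(Y + tE)|_{t=0} = i! coeff_i`;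
* `FawziEtAl2015_thm510`: the printed statement for the pencil `C + Σ z_j A_j`;
* `exists_renegarDerivative_polynomials`: the `g^{(i)}` are polynomials in `z` of total degree
  `≤ k` ("`Q` is a semialgebraic set described by `g^{(i)}(z) ≥ 0`": `k` inequalities of degree
  `≤ k`, the count used in [FawziEtAl2015, Prop. 5.12]).

Related tree material, not restated: the abstract derivative cone of a hyperbolic polynomial
(`DerivativeCone.lean`, Renegar Prop. 18 for `i = 1`), the coefficient sign test in direction `I`
(`Literature.LinearAlgebra.Matrix.CharpolySignAlternation`), and its use for psd lifts
(`Literature.Combinatorics.Optimization.PsdLiftAlgebraicBoundary`).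
-/

noncomputable section

open Matrix Polynomial Finset
open scoped BigOperators Polynomial

namespace Literature.AlgebraicGeometry.HyperbolicPolynomials

open Literature.LinearAlgebra.Matrix.CharpolySignAlternation (forall_nonneg_iff_esymmSum_nonneg)

section RenegarDerivatives

variable {ι : Type*} [Fintype ι] [DecidableEq ι]

/-- A real positive definite matrix is `RᵀR` with `R` invertible (`R = diag(√λ) Uᵀ` from the
spectral theorem). [folklore] -/
private theorem exists_transpose_mul_self_eq_of_posDef {E : Matrix ι ι ℝ} (hE : E.PosDef) :
    ∃ R : Matrix ι ι ℝ, IsUnit R.det ∧ Rᵀ * R = E := by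
  have hspec := hE.1.spectral_theorem
  rw [Unitary.conjStarAlgAut_apply] at hspec
  set U : Matrix ι ι ℝ := (hE.1.eigenvectorUnitary : Matrix ι ι ℝ) with hU
  have hUmem : U ∈ Matrix.unitaryGroup ι ℝ := hE.1.eigenvectorUnitary.2
  set d : ι → ℝ := fun i => Real.sqrt (hE.1.eigenvalues i) with hd
  refine ⟨diagonal d * star U, ?_, ?_⟩
  · rw [det_mul, IsUnit.mul_iff, det_diagonal]
    refine ⟨isUnit_iff_ne_zero.mpr (Finset.prod_ne_zero_iff.mpr fun i _ => ?_), ?_⟩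
    · exact (Real.sqrt_pos.mpr (hE.eigenvalues_pos i)).ne'
    · exact Matrix.UnitaryGroup.det_isUnit ⟨_, Unitary.star_mem hUmem⟩
  · have hdiag : (diagonal fun i => d i * d i) = diagonal (RCLike.ofReal ∘ hE.1.eigenvalues) := by
      congr 1
      funext i
      simp only [hd, Function.comp_apply, Real.mul_self_sqrt (hE.eigenvalues_pos i).le]
      rfl
    rw [← conjTranspose_eq_transpose_of_trivial, conjTranspose_mul, star_eq_conjTranspose,
      conjTranspose_conjTranspose, diagonal_conjTranspose, Matrix.mul_assoc,
      ← Matrix.mul_assoc (diagonal _), diagonal_mul_diagonal]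
    have hstar : star d = d := by funext i; simp
    rw [hstar, hdiag, ← Matrix.mul_assoc, ← star_eq_conjTranspose, ← hspec]

/-- The line polynomial `t ↦ det(W + tI)` of a real symmetric matrix is `∏ᵢ (t + λᵢ(W))`.
[folklore] -/
private theorem det_map_add_X_smul_one_eq_prod {W : Matrix ι ι ℝ} (hW : W.IsHermitian) :
    (W.map C + (X : ℝ[X]) • (1 : Matrix ι ι ℝ[X])).det = ∏ i, (X + C (hW.eigenvalues i)) := by
  apply Polynomial.funext
  intro t
  have h1 : ((W.map C + (X : ℝ[X]) • (1 : Matrix ι ι ℝ[X])).det).eval t =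
      (W + t • (1 : Matrix ι ι ℝ)).det := by
    rw [← Polynomial.coe_evalRingHom, RingHom.map_det]
    congr 1
    ext a b
    simp only [RingHom.mapMatrix_apply, Matrix.map_apply, Matrix.add_apply, Matrix.smul_apply,
      Matrix.one_apply, smul_eq_mul, Polynomial.coe_evalRingHom, eval_add, eval_C,
      mul_ite, mul_one, mul_zero]
    split_ifs <;> simp
  have h2 : W + t • (1 : Matrix ι ι ℝ) = -(Matrix.scalar ι (-t) - W) := by
    ext a b
    simp only [Matrix.add_apply, Matrix.smul_apply, Matrix.one_apply, smul_eq_mul, Matrix.neg_apply,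
      Matrix.sub_apply, Matrix.scalar_apply, Matrix.diagonal_apply]
    split_ifs <;> ring
  rw [h1, h2, det_neg, ← Matrix.eval_charpoly, hW.charpoly_eq, eval_prod, eval_prod]
  simp only [eval_sub, eval_X, eval_C, eval_add, RCLike.ofReal_real_eq_id, id_eq]
  rw [← Finset.card_univ, ← Finset.prod_const, ← Finset.prod_mul_distrib]
  exact Finset.prod_congr rfl fun i _ => by ring

/-- **Renegar's description of the semidefinite cone along a positive definite direction,
coefficient form.** For real symmetric `Y` and positive definite `E` of size `k`:
`Y ⪰ 0 ⟺ coeff_i det(Y + tE) ≥ 0` for all `i < k` — with `E = RᵀR`, `det(Y + tE) =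
(det R)² ∏ (t + λᵢ(R⁻ᵀ Y R⁻¹))`, whose coefficients are the elementary symmetric functions of the
eigenvalues, all nonnegative iff the eigenvalues are (Renegar 2006, Prop. 18 and Thm. 20 for the
hyperbolic polynomial `det` in direction `E`). [cite: Renegar2006, Prop. 18 and Thm. 20] -/
theorem posSemidef_iff_coeff_det_add_smul_nonneg {Y E : Matrix ι ι ℝ} (hY : Y.IsSymm)
    (hE : E.PosDef) :
    Y.PosSemidef ↔ ∀ i < Fintype.card ι,
      0 ≤ ((Y.map C + (X : ℝ[X]) • E.map C).det).coeff i := by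
  obtain ⟨R, hRunit, hRE⟩ := exists_transpose_mul_self_eq_of_posDef hE
  have hRdet : R.det ≠ 0 := hRunit.ne_zero
  -- `W = R⁻ᵀ Y R⁻¹` is symmetric, congruent to `Y`
  set W : Matrix ι ι ℝ := (R⁻¹)ᵀ * Y * R⁻¹ with hWdef
  have hRinv : R⁻¹ * R = 1 := Matrix.nonsing_inv_mul R hRunit
  have hRinv' : R * R⁻¹ = 1 := Matrix.mul_nonsing_inv R hRunit
  have hYW : Rᵀ * W * R = Y := by
    rw [hWdef, Matrix.transpose_nonsing_inv]
    calc Rᵀ * (Rᵀ⁻¹ * Y * R⁻¹) * R = (Rᵀ * Rᵀ⁻¹) * Y * (R⁻¹ * R) := by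
          simp only [Matrix.mul_assoc]
      _ = Y := by
          rw [Matrix.mul_nonsing_inv Rᵀ (by rwa [det_transpose]), hRinv, Matrix.one_mul,
            Matrix.mul_one]
  have hWh : W.IsHermitian := by
    have hYh : Y.IsHermitian := by
      rw [Matrix.IsHermitian, conjTranspose_eq_transpose_of_trivial]; exact hY
    have := Matrix.isHermitian_conjTranspose_mul_mul R⁻¹ hYh
    rwa [conjTranspose_eq_transpose_of_trivial] at this
  -- psd transfers along the congruence
  have hpsd : Y.PosSemidef ↔ W.PosSemidef := by
    constructor
    · intro h
      have := h.conjTranspose_mul_mul_same R⁻¹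
      rwa [conjTranspose_eq_transpose_of_trivial] at this
    · intro h
      have := h.conjTranspose_mul_mul_same R
      rwa [conjTranspose_eq_transpose_of_trivial, hYW] at this
  -- the line polynomial factors: `det(Y + tE) = (det R)² det(W + tI)`
  have hfac : (Y.map C + (X : ℝ[X]) • E.map C).det =
      C (R.det ^ 2) * (W.map C + (X : ℝ[X]) • (1 : Matrix ι ι ℝ[X])).det := by
    have hmat : Y.map C + (X : ℝ[X]) • E.map C =
        (Rᵀ).map C * (W.map C + (X : ℝ[X]) • (1 : Matrix ι ι ℝ[X])) * R.map C := by
      rw [Matrix.mul_add, Matrix.add_mul, Matrix.mul_smul, Matrix.smul_mul, Matrix.mul_one,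
        ← Matrix.map_mul, ← Matrix.map_mul, hYW, ← Matrix.map_mul, hRE]
    rw [hmat, det_mul, det_mul]
    have hd1 : (Rᵀ.map (C : ℝ →+* ℝ[X])).det = C R.det := by
      rw [← RingHom.mapMatrix_apply, ← RingHom.map_det, det_transpose]
    have hd2 : (R.map (C : ℝ →+* ℝ[X])).det = C R.det := by
      rw [← RingHom.mapMatrix_apply, ← RingHom.map_det]
    rw [hd1, hd2, sq, map_mul]
    ring
  rw [hpsd, hWh.posSemidef_iff_eigenvalues_nonneg, hfac, det_map_add_X_smul_one_eq_prod hWh]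
  -- coefficients of `∏ (X + λᵢ)` are the elementary symmetric functions
  have hcoeff : ∀ i ≤ Fintype.card ι, (∏ j, (X + C (hWh.eigenvalues j))).coeff i =
      ∑ u ∈ (univ : Finset ι).powersetCard (Fintype.card ι - i), ∏ j ∈ u, hWh.eigenvalues j := by
    intro i hi
    rw [Finset.prod_X_add_C_coeff univ _ (by rwa [card_univ]), card_univ]
  have hR2 : 0 < R.det ^ 2 := by positivity
  constructor
  · intro h i hi
    rw [coeff_C_mul, hcoeff i hi.le]
    refine mul_nonneg hR2.le ?_
    have h' : ∀ j ∈ (univ : Finset ι), 0 ≤ hWh.eigenvalues j := fun j _ => h j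
    exact ((forall_nonneg_iff_esymmSum_nonneg univ hWh.eigenvalues).1 h') _
      (by rw [card_univ]; omega)
  · intro h
    have h' : ∀ j ∈ (univ : Finset ι), 0 ≤ hWh.eigenvalues j := by
      refine (forall_nonneg_iff_esymmSum_nonneg univ hWh.eigenvalues).2 fun m hm => ?_
      rw [card_univ] at hm
      rcases Nat.eq_zero_or_pos m with rfl | hmpos
      · simp
      · have hi : Fintype.card ι - m < Fintype.card ι := by omega
        have := h _ hi
        rw [coeff_C_mul, hcoeff _ hi.le, Nat.sub_sub_self hm] at this
        exact (mul_nonneg_iff_of_pos_left hR2).1 this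
    intro j
    exact h' j (mem_univ j)

/-- **Renegar's description, derivative form** (the `i`-th Renegar derivative in direction `E`
of `g^{(0)} = det` at `Y` is `(d/dt)^i det(Y + tE)|_{t=0} = i! · coeff_i det(Y + tE)`): for real
symmetric `Y` and `E ≻ 0` of size `k`, `Y ⪰ 0 ⟺ (d/dt)^i det(Y + tE)|_{t=0} ≥ 0` for `i < k`.
[cite: Renegar2006, Prop. 18 and Thm. 20] -/
theorem posSemidef_iff_iterate_derivative_det_add_smul_nonneg {Y E : Matrix ι ι ℝ} (hY : Y.IsSymm)
    (hE : E.PosDef) :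
    Y.PosSemidef ↔ ∀ i < Fintype.card ι,
      0 ≤ ((derivative^[i]) (Y.map C + (X : ℝ[X]) • E.map C).det).eval 0 := by
  rw [posSemidef_iff_coeff_det_add_smul_nonneg hY hE]
  refine forall_congr' fun i => imp_congr_right fun _ => ?_
  rw [← coeff_zero_eq_eval_zero, coeff_iterate_derivative, zero_add, Nat.descFactorial_self,
    nsmul_eq_mul]
  exact (mul_nonneg_iff_of_pos_left (by positivity)).symm

end RenegarDerivatives

/-! ### FGPRT Theorem 5.10: the spectrahedron of a pencil with a positive definite point -/

section Pencil

variable {k m : ℕ}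

/-- **FGPRT Theorem 5.10** (Renegar 2006; GPT13 Thm 4.16; p16, verbatim): "Let
`Q = {z ∈ ℝ^m : C + Σ z_i A_i ⪰ 0}` be a spectrahedron with `E := C + Σ z'_i A_i ≻ 0` for some
`z' ∈ Q`, and `C, A_i` are symmetric matrices of size `k × k`. Then `Q` is a semialgebraic set
described by `g^{(i)}(z) ≥ 0` for `i = 1, …, k` where `g^{(0)}(z) := det(C + Σ z_i A_i)` and
`g^{(i)}(z)` is the `i`-th Renegar derivative of `g^{(0)}(z)` in direction `E`." Here
`g^{(i)}(z) = (d/dt)^i det(C + Σ z_j A_j + tE)|_{t=0}` and the describing family is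
`g^{(0)}, …, g^{(k−1)}` (the printed range "`i = 1, …, k`" is an index slip: `g^{(k)} = k! det E`
is a positive constant and `g^{(0)} ≥ 0` is needed — `{g^{(1)} ≥ 0, …}` alone is Renegar's larger
derivative cone); that the `g^{(i)}` are polynomials in `z` of degree `≤ k` is
`exists_renegarDerivative_polynomials`. [cite: FawziEtAl2015, Thm 5.10 (p16)] -/
theorem FawziEtAl2015_thm510 (C₀ : Matrix (Fin k) (Fin k) ℝ) (A : Fin m → Matrix (Fin k) (Fin k) ℝ)
    (hC₀ : C₀.IsSymm) (hA : ∀ j, (A j).IsSymm) {z' : Fin m → ℝ}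
    (hE : (C₀ + ∑ j, z' j • A j).PosDef) (z : Fin m → ℝ) :
    (C₀ + ∑ j, z j • A j).PosSemidef ↔ ∀ i < k,
      0 ≤ ((derivative^[i]) ((C₀ + ∑ j, z j • A j).map C +
        (X : ℝ[X]) • (C₀ + ∑ j, z' j • A j).map C).det).eval 0 := by
  have hYs : (C₀ + ∑ j, z j • A j).IsSymm := by
    have h2 : (∑ j, z j • A j).IsSymm := by
      unfold Matrix.IsSymm
      rw [Matrix.transpose_sum]
      exact Finset.sum_congr rfl fun j _ => by rw [Matrix.transpose_smul, (hA j).eq]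
    exact hC₀.add h2
  have h := posSemidef_iff_iterate_derivative_det_add_smul_nonneg hYs hE
  rwa [Fintype.card_fin] at h

/-- The determinant of a square matrix of polynomials of total degree `≤ 1` has total degree at
most the size of the matrix. [folklore] -/
private theorem totalDegree_det_le_card' {σ : Type*} {ι : Type*} [Fintype ι] [DecidableEq ι]
    (M : Matrix ι ι (MvPolynomial σ ℝ)) (hM : ∀ i j, (M i j).totalDegree ≤ 1) :
    M.det.totalDegree ≤ Fintype.card ι := by
  rw [Matrix.det_apply']
  refine MvPolynomial.totalDegree_finsetSum_le fun τ _ => ?_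
  calc (((Equiv.Perm.sign τ : ℤ) : MvPolynomial σ ℝ) * ∏ i, M (τ i) i).totalDegree
      ≤ ((Equiv.Perm.sign τ : ℤ) : MvPolynomial σ ℝ).totalDegree +
          (∏ i, M (τ i) i).totalDegree := MvPolynomial.totalDegree_mul _ _
    _ ≤ 0 + ∑ i, (M (τ i) i).totalDegree := by
        refine add_le_add (le_of_eq ?_) (MvPolynomial.totalDegree_finsetProd _ _)
        rw [← map_intCast (MvPolynomial.C : ℝ →+* MvPolynomial σ ℝ), MvPolynomial.totalDegree_C]
    _ ≤ 0 + ∑ _i : ι, 1 := by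
        exact add_le_add le_rfl (Finset.sum_le_sum fun i _ => hM _ _)
    _ = Fintype.card ι := by simp [Finset.card_univ]

/-- **The Renegar derivatives of a pencil are polynomials of degree `≤ k`** ("`Q` is a
semialgebraic set described by `g^{(i)}(z) ≥ 0`", `k` polynomial inequalities of degree at most
`k`): there are `G_i ∈ ℝ[z_1, …, z_m]` of total degree `≤ k` with
`G_i(z) = (d/dt)^i det(C + Σ z_j A_j + tE)|_{t=0}` for all `z` and `i` (namely `i!` times the
coefficient of `t^i` of the symbolic determinant). [cite: FawziEtAl2015, Thm 5.10 (p16)] -/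
theorem exists_renegarDerivative_polynomials (C₀ : Matrix (Fin k) (Fin k) ℝ)
    (A : Fin m → Matrix (Fin k) (Fin k) ℝ) (E : Matrix (Fin k) (Fin k) ℝ) :
    ∃ G : ℕ → MvPolynomial (Fin m) ℝ, (∀ i, (G i).totalDegree ≤ k) ∧
      ∀ (z : Fin m → ℝ) (i : ℕ), MvPolynomial.eval z (G i) =
        ((derivative^[i]) ((C₀ + ∑ j, z j • A j).map C + (X : ℝ[X]) • E.map C).det).eval 0 := by
  classical
  -- the symbolic matrix over `ℝ[X_0, …, X_m]` (`X_0 ↔ t`, `X_{j+1} ↔ z_j`)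
  let M : Matrix (Fin k) (Fin k) (MvPolynomial (Fin (m + 1)) ℝ) := Matrix.of fun a b =>
    MvPolynomial.C (C₀ a b) + ∑ j, MvPolynomial.X (Fin.succ j) * MvPolynomial.C (A j a b) +
      MvPolynomial.X 0 * MvPolynomial.C (E a b)
  let D : MvPolynomial (Fin (m + 1)) ℝ := M.det
  have hM : ∀ a b, (M a b).totalDegree ≤ 1 := by
    intro a b
    simp only [M, Matrix.of_apply]
    refine (MvPolynomial.totalDegree_add _ _).trans (max_le ((MvPolynomial.totalDegree_add _ _).trans
      (max_le (by simp) ?_)) ?_)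
    · refine MvPolynomial.totalDegree_finsetSum_le fun j _ =>
        (MvPolynomial.totalDegree_mul _ _).trans ?_
      rw [MvPolynomial.totalDegree_C, add_zero]
      exact (MvPolynomial.totalDegree_X (R := ℝ) (Fin.succ j)).le
    · refine (MvPolynomial.totalDegree_mul _ _).trans ?_
      rw [MvPolynomial.totalDegree_C, add_zero]
      exact (MvPolynomial.totalDegree_X (R := ℝ) (0 : Fin (m + 1))).le
  have hD : D.totalDegree ≤ k := by simpa using totalDegree_det_le_card' M hM
  refine ⟨fun i => (i.factorial : ℝ) • ((MvPolynomial.finSuccEquiv ℝ m) D).coeff i, fun i => ?_,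
    fun z i => ?_⟩
  · show ((i.factorial : ℝ) • ((MvPolynomial.finSuccEquiv ℝ m) D).coeff i).totalDegree ≤ k
    refine (MvPolynomial.totalDegree_smul_le _ _).trans ?_
    by_cases hci : ((MvPolynomial.finSuccEquiv ℝ m) D).coeff i = 0
    · simp only [hci, MvPolynomial.totalDegree_zero, Nat.zero_le]
    · have h := MvPolynomial.totalDegree_coeff_finSuccEquiv_add_le D i hci
      omega
  · set P : ℝ[X] := ((C₀ + ∑ j, z j • A j).map C + (X : ℝ[X]) • E.map C).det with hP
    -- the specialised polynomial `t ↦ D(t, z)` is `P`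
    have hpeval : ∀ t : ℝ, (Polynomial.map (MvPolynomial.eval z)
        ((MvPolynomial.finSuccEquiv ℝ m) D)).eval t = P.eval t := by
      intro t
      rw [← MvPolynomial.eval_eq_eval_mv_eval', hP, ← Polynomial.coe_evalRingHom,
        show MvPolynomial.eval (Fin.cons t z) D =
          ((MvPolynomial.eval (Fin.cons t z)).mapMatrix M).det from
          RingHom.map_det (MvPolynomial.eval (Fin.cons t z)) M, RingHom.map_det]
      congr 1
      ext a b
      simp only [RingHom.mapMatrix_apply, Matrix.map_apply, M, Matrix.of_apply, map_add, map_sum,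
        map_mul, MvPolynomial.eval_C, MvPolynomial.eval_X, Fin.cons_succ, Fin.cons_zero,
        Matrix.add_apply, Matrix.smul_apply, Matrix.sum_apply, smul_eq_mul, Polynomial.coe_evalRingHom,
        eval_add, eval_mul, eval_X, eval_C, Polynomial.eval_finsetSum, mul_comm]
    have hp : Polynomial.map (MvPolynomial.eval z) ((MvPolynomial.finSuccEquiv ℝ m) D) = P :=
      Polynomial.funext hpeval
    show MvPolynomial.eval z ((i.factorial : ℝ) • ((MvPolynomial.finSuccEquiv ℝ m) D).coeff i) = _
    rw [MvPolynomial.smul_eval, ← Polynomial.coeff_map, hp, ← coeff_zero_eq_eval_zero,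
      coeff_iterate_derivative, zero_add, Nat.descFactorial_self, nsmul_eq_mul]

end Pencil

end Literature.AlgebraicGeometry.HyperbolicPolynomials
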